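import Summits.Ventures.PercRepro.ColumnSum

/-!
# Lemma B is trivial when one colour class dominates

For a monotone map `c` and a crossing family `x`, the column `C_i = columnSet x c i` (the bad
members of cell `x_i`) satisfies `columnCount i ≤ topBotCount` by Marica–Schönheim
(`columnCount_le_topBotCount`). Hence Lemma B, `crossCount ≤ topBotCount`, holds outright as soon as
some column is at least as large as the number of bad pairs: `crossCount ≤ columnCount i`. Since
`2·crossCount = Σ_i columnCount i`, this is the case exactly when one column is at least the sum of
the other two. So the open case of Lemma B is the BALANCED regime, in which every column is
strictly smaller than the sum of the other two (the three column counts satisfy the strict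
triangle inequalities), and in particular every column is `< crossCount`
(`lemmaB_or_columns_lt`). The `d = 10` minimisers of `g − 2b` (proofs/P4-gen7.md §6.3) sit at the
edge of that regime: two columns of size `b − 1` and one of size `2`.
-/

namespace PercRepro

open Finset

section Dominant

variable {S : Type} [Fintype S] [DecidableEq S] {k r : ℕ} (x : Fin r → Setoid (Fin k))
  (c : Config S → Setoid (Fin k))

/-- **Lemma B when a column dominates**: if the bad pairs are at most the bad members of one
cell, Lemma B follows from Marica–Schönheim on that column. -/
theorem crossCount_le_topBotCount_of_le_columnCount (hx : IsCrossingFamily x) (hc : Monotone c)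
    (i : Fin r) (h : crossCount x c ≤ columnCount x c i) : crossCount x c ≤ topBotCount c :=
  le_trans h (columnCount_le_topBotCount x c hx hc i)

/-- **Lemma B or the balanced regime**: either `crossCount ≤ topBotCount`, or every column is
strictly smaller than the number of bad pairs (equivalently, by `2·crossCount = Σ columnCount`,
strictly smaller than the sum of the other columns). -/
theorem lemmaB_or_columns_lt (hx : IsCrossingFamily x) (hc : Monotone c) :
    crossCount x c ≤ topBotCount c ∨ ∀ i : Fin r, columnCount x c i < crossCount x c := by
  by_cases h : ∀ i : Fin r, columnCount x c i < crossCount x c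
  · exact Or.inr h
  · push Not at h
    obtain ⟨i, hi⟩ := h
    exact Or.inl (crossCount_le_topBotCount_of_le_columnCount x c hx hc i hi)

end Dominant

end PercRepro
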